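import Summits.Ventures.DiscreteObjects.PP12.FanoFiveWordChecker

/-!
# PP(12), order 5: SOUNDNESS of the word-code checker — `noWordCode_of_checked`, `noOrderFive_of_checked` (kernel)
Framing: lottery ticket; floor = certified bounds/negative ranges.

Cell pub-namedobj (venture DiscreteObjects), target (M), designs gen 17; continues `FanoFiveWordChecker`. `scan_sound` / **`noCompl_sound`**: if
`Cert.noCompl k ws cands = true` (`cands ⊆ W4`) then no sublist `C` of `cands` of length `k` makes `ws ++ C` pass the leaf test `FullP`; and from a word
code `W` (`FanoFiveECodeWords.IsWordCode`) the list `[0, 95, 63] ++ A ++ C` (its weight-2 and weight-4 words in increasing order) passes `FullP`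
(`hd = hdist` on 7-bit words by a `decide`d popcount table; counts over the list = cardinalities over `W`). Hence
**`Cert.noWordCode_of_checked : (∀ A, A <+ W2 → A.length = 4 → noCompl 9 ([0, 95, 63] ++ A) W4 = true) → NoWordCode`** and
**`noOrderFive_of_checked`** — the order-5 cell of PP(12) is a kernel theorem modulo ONE computable hypothesis, to be discharged by `decide +kernel`
(≈ 8·10⁵ DFS nodes over orbit representatives, ≤ ≈ 400 nodes per theorem; successor campaign, HANDOFF (c)). Nothing is discharged here; nothing asserts
any census statement. No `sorry`, no new axioms.
-/

namespace Summit.Ventures.DiscreteObjects.PP12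

open Finset

namespace FanoFive

namespace Cert

/-! ### soundness of the search -/

/-- what `scan` guarantees for a sublist starting with `c` -/
theorem scan_sound {f : List ℕ → List ℕ → Bool} {es : List (ℕ × ℕ × ℕ × ℕ)} {ws : List ℕ} :
    ∀ {cands : List ℕ}, scan f es ws cands = true → ∀ {c : ℕ} {C' : List ℕ}, (c :: C').Sublist cands →
      okAdd es ws c = false ∨ ∃ cs, C'.Sublist cs ∧ cs.Sublist cands ∧ f (ws ++ [c]) cs = true
  | [], _, c, C', hsub => by simp at hsub
  | d :: ds, hs, c, C', hsub => by
    simp only [scan, Bool.and_eq_true, Bool.or_eq_true, Bool.not_eq_true'] at hs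
    obtain ⟨h1, h2⟩ := hs
    rcases hsub with _ | ⟨_, hsub'⟩ | ⟨_, hsub'⟩
    · -- `c :: C'` is a sublist of `ds`
      rcases scan_sound h2 hsub' with hp | ⟨cs, hC', hcs, hf⟩
      · exact Or.inl hp
      · exact Or.inr ⟨cs, hC', hcs.trans (List.sublist_cons_self d ds), hf⟩
    · -- `c = d` and `C'` is a sublist of `ds`
      rcases h1 with hp | hf
      · exact Or.inl hp
      · exact Or.inr ⟨ds, hsub', List.sublist_cons_self d ds, hf⟩

/-- **soundness of the checker**: no completion by `k` weight-4 words taken as a sublist of `cands ⊆ W4` -/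
theorem noCompl_sound : ∀ (k : ℕ) (ws cands : List ℕ), (∀ c ∈ cands, c ∈ W4) → noCompl k ws cands = true →
    ∀ C : List ℕ, C.Sublist cands → C.length = k → ¬ FullP (ws ++ C)
  | 0, ws, cands, _, h, C, _, hlen => by
    have hC : C = [] := List.length_eq_zero_iff.1 hlen
    subst hC
    simp only [noCompl, Bool.not_eq_true', decide_eq_false_iff_not] at h
    simpa using h
  | k + 1, ws, cands, hcands, h, C, hsub, hlen => by
    simp only [noCompl, Bool.or_eq_true, Bool.not_eq_true'] at h
    have hCW : ∀ c ∈ C, c ∈ W4 := fun c hc => hcands c (hsub.subset hc)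
    rcases h with h | h
    · rw [← hlen] at h
      exact not_fullP_of_feas_false hCW h
    · obtain ⟨c, C', rfl⟩ : ∃ c C', C = c :: C' := by
        cases C with
        | nil => simp at hlen
        | cons c C' => exact ⟨c, C', rfl⟩
      rcases scan_sound h hsub with hp | ⟨cs, hC', hcs, hf⟩
      · -- rejected: cap or column violated in `ws ++ [c]`, a sublist of `ws ++ c :: C'`
        have hsub2 : (ws ++ [c]).Sublist (ws ++ c :: C') := by
          refine List.Sublist.append_left ?_ ws
          exact (List.cons_sublist_cons.2 (List.nil_sublist C'))
        exact not_fullP_of_okAdd_false hsub2 hp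
      · have hlen' : C'.length = k := by simpa using hlen
        have hcs' : ∀ c' ∈ cs, c' ∈ W4 := fun c' hc' => hcands c' (hcs.subset hc')
        have := noCompl_sound k (ws ++ [c]) cs hcs' hf C' hC' hlen'
        rwa [List.append_assoc] at this


/-! ### from a word code to a full list -/

/-- cardinality of a filter of `Fin 7` as the length of a filtered `List.finRange` -/
theorem card_filter_fin7 (p : Fin 7 → Prop) [DecidablePred p] :
    (univ.filter p).card = ((List.finRange 7).filter fun x => decide (p x)).length := by
  rw [Fin.univ_def]
  rfl

/-- the arithmetic popcount counts the set low bits (checked on all 7-bit words) -/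
theorem popc7_eq : ∀ n < 128, popc7 n = ((List.finRange 7).filter fun x : Fin 7 => n.testBit x).length := by decide

/-- the kernel-evaluable distance agrees with `hdist` on 7-bit words -/
theorem hd_eq_hdist {v w : ℕ} (hv : v < 128) (hw : w < 128) : hd v w = hdist v w := by
  unfold hd hdist
  have hx : v ^^^ w < 128 := Nat.xor_lt_two_pow (n := 7) hv hw
  rw [popc7_eq _ hx, card_filter_fin7]
  congr 1
  refine List.filter_congr fun x _ => ?_
  rw [Nat.testBit_xor]
  by_cases h : v.testBit x = w.testBit x <;> simp [h]

/-- counting over a list without repetition = cardinality of the filtered `toFinset` -/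
theorem countP_eq_card_filter {L : List ℕ} (hL : L.Nodup) (p : ℕ → Bool) :
    L.countP p = (L.toFinset.filter fun w => p w = true).card := by
  rw [← List.toFinset_filter, List.toFinset_card_of_nodup (hL.filter _), List.countP_eq_length_filter]

/-- the weight classes of 7-bit words, by `decide` -/
theorem mem_W2_iff : ∀ w < 128, (w ∈ W2 ↔ hdist 0 w = 2) := by decide
/-- the weight classes of 7-bit words, by `decide` -/
theorem mem_W4_iff : ∀ w < 128, (w ∈ W4 ↔ hdist 0 w = 4) := by decide
/-- bookkeeping about the fixed words and the two lists, by `decide` -/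
theorem lists_facts : W2.Nodup ∧ W4.Nodup ∧ (∀ w ∈ W2, w ∉ W4) ∧ 0 ∉ W2 ∧ 0 ∉ W4 ∧ 95 ∉ W2 ∧ 95 ∉ W4 ∧ 63 ∉ W2 ∧ 63 ∉ W4 ∧
    hdist 0 95 = 6 ∧ hdist 0 63 = 6 := by decide

/-- **SOUNDNESS OF THE CERTIFICATE FORMAT: if the checker refutes every choice of the four weight-2 words, there is no word code.** -/
theorem noWordCode_of_checked (hcheck : ∀ A : List ℕ, A.Sublist W2 → A.length = 4 → noCompl 9 ([0, 95, 63] ++ A) W4 = true) :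
    NoWordCode := by
  intro W hW
  obtain ⟨n2, n4, h24, h0_2, h0_4, h95_2, h95_4, h63_2, h63_4, d95, d63⟩ := lists_facts
  -- the weight-2 and weight-4 parts of `W`, as increasing lists
  set A : List ℕ := W2.filter fun w => decide (w ∈ W) with hAdef
  set C : List ℕ := W4.filter fun w => decide (w ∈ W) with hCdef
  have hAsub : A.Sublist W2 := List.filter_sublist
  have hCsub : C.Sublist W4 := List.filter_sublist
  have hAmem : ∀ w, w ∈ A ↔ w ∈ W2 ∧ w ∈ W := fun w => by simp [hAdef]
  have hCmem : ∀ w, w ∈ C ↔ w ∈ W4 ∧ w ∈ W := fun w => by simp [hCdef]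
  have hAnd : A.Nodup := n2.filter _
  have hCnd : C.Nodup := n4.filter _
  -- their lengths, from the profile of the zero word
  have hAlen : A.length = 4 := by
    rw [← List.toFinset_card_of_nodup hAnd, ← hW.two 0 hW.zero_mem]
    congr 1
    ext w
    simp only [List.mem_toFinset, hAmem, Finset.mem_filter]
    constructor
    · rintro ⟨h2, hw⟩; exact ⟨hw, (mem_W2_iff w (hW.lt w hw)).1 h2⟩
    · rintro ⟨hw, hd2⟩; exact ⟨(mem_W2_iff w (hW.lt w hw)).2 hd2, hw⟩
  have hClen : C.length = 9 := by
    rw [← List.toFinset_card_of_nodup hCnd, ← hW.four 0 hW.zero_mem]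
    congr 1
    ext w
    simp only [List.mem_toFinset, hCmem, Finset.mem_filter]
    constructor
    · rintro ⟨h4, hw⟩; exact ⟨hw, (mem_W4_iff w (hW.lt w hw)).1 h4⟩
    · rintro ⟨hw, hd4⟩; exact ⟨(mem_W4_iff w (hW.lt w hw)).2 hd4, hw⟩
  -- the full list
  set L : List ℕ := ([0, 95, 63] ++ A) ++ C with hLdef
  have hLmem : ∀ w, w ∈ L → w ∈ W := by
    intro w hw
    simp only [hLdef, List.mem_append, List.mem_cons, List.mem_nil_iff, or_false] at hw
    rcases hw with ((rfl | rfl | rfl) | hA) | hC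
    · exact hW.zero_mem
    · exact hW.w5_mem
    · exact hW.w6_mem
    · exact ((hAmem w).1 hA).2
    · exact ((hCmem w).1 hC).2
  have hLnd : L.Nodup := by
    rw [hLdef, List.nodup_append]
    refine ⟨?_, hCnd, ?_⟩
    · rw [List.nodup_append]
      refine ⟨by simp, hAnd, ?_⟩
      intro w hw w' hw' e
      subst e
      simp only [List.mem_cons, List.mem_nil_iff, or_false] at hw
      have hw2 : w ∈ W2 := ((hAmem w).1 hw').1
      rcases hw with rfl | rfl | rfl
      · exact h0_2 hw2
      · exact h95_2 hw2
      · exact h63_2 hw2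
    · intro w hw w' hw' e
      subst e
      have hw4 : w ∈ W4 := ((hCmem w).1 hw').1
      simp only [List.mem_append, List.mem_cons, List.mem_nil_iff, or_false] at hw
      rcases hw with (rfl | rfl | rfl) | hA
      · exact h0_4 hw4
      · exact h95_4 hw4
      · exact h63_4 hw4
      · exact h24 w ((hAmem w).1 hA).1 hw4
  have hLlen : L.length = 16 := by simp [hLdef, hAlen, hClen]
  have hLW : L.toFinset = W := by
    apply Finset.eq_of_subset_of_card_le
    · intro w hw; exact hLmem w (List.mem_toFinset.1 hw)
    · rw [hW.card_eq, List.toFinset_card_of_nodup hLnd, hLlen]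
  -- counts over `L` are cardinalities over `W`
  have hcount : ∀ p : ℕ → Bool, L.countP p = (W.filter fun w => p w = true).card := fun p => by
    rw [countP_eq_card_filter hLnd, hLW]
  -- `L` passes the leaf test
  have hFull : FullP L := by
    refine ⟨fun x => ?_, fun u hu => ?_, fun x y hxy => ?_⟩
    · unfold colc; rw [hcount]; exact hW.balanced x
    · have huW := hLmem u hu
      unfold cntd
      rw [hcount, hcount, hcount]
      have hu128 : u < 128 := hW.lt u huW
      have e : ∀ d : ℕ, (W.filter fun w => (hd u w == d) = true) = W.filter fun w => hdist u w = d := fun d => by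
        refine Finset.filter_congr fun w hw => ?_
        rw [← hd_eq_hdist hu128 (hW.lt w hw)]; simp
      rw [e, e, e]
      exact ⟨hW.two u huW, hW.four u huW, hW.six u huW⟩
    · unfold colpair
      rw [hcount]
      have e : (W.filter fun w => (w.testBit x != w.testBit y) = true) = W.filter fun w => w.testBit x ≠ w.testBit y := by
        ext w; simp
      rw [e]
      exact hW.corr x y hxy
  -- but the checker refutes it
  exact noCompl_sound 9 ([0, 95, 63] ++ A) W4 (fun c hc => hc) (hcheck A hAsub hAlen) C hCsub hClen hFull

end Cert

/-- **The order-5 cell of PP(12) from the checker** (entry point of the kernel certificate; the hypothesis is discharged by `decide +kernel`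
per quadruple of weight-2 words — successor item). -/
theorem noOrderFive_of_checked
    (hcheck : ∀ A : List ℕ, A.Sublist Cert.W2 → A.length = 4 → Cert.noCompl 9 ([0, 95, 63] ++ A) Cert.W4 = true) : NoOrderFiveOrder12 :=
  noOrderFive_of_noWordCode (Cert.noWordCode_of_checked hcheck)

end FanoFive

end Summit.Ventures.DiscreteObjects.PP12
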